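import Literature.MathematicalPhysics.QuantumFieldTheory.Balaban1983to89.B3MultiscaleFields

/-!
# `Balaban1983to89.HiggsFluctMeasure` — T. Bałaban, *(Higgs)₂,₃ quantum fields in a finite volume. I. A lower bound*,
Commun. Math. Phys. **85** (1982) 603–626 [Balaban1982Higgs1] pp. 610–611, 617–618 and *III. Renormalization*,
Commun. Math. Phys. **88** (1983) 411–445 [Balaban1983Higgs3] p. 412: the fluctuation covariances `C^{(j),L^jη}` of the
VECTOR field ((I.2.21), (I.2.30) at *"N = d, external field A = 0"*) and the Gaussian measures `dμ_{C^{(j),L^jη}}(A′_j)`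
of (III.1.4) / (I.3.35), CONCRETELY over the carriers `…HiggsLattice` / `…HiggsAveraging` / `…HiggsCovariance` /
`…B3MultiscaleFields`

statement-level skeleton of published theorems with citation tags; proofs where landed; nothing here is a claim about the Yang–Mills mass gap

PDFs held: `paper:balaban1982-cmp85-higgs23-i` (journal page = PDF page + 602) and
`paper:balaban1983-higgs-2-3-quantum-fields-finite-volume` (journal page = PDF page + 410).  Displays read on the ×2
renders `run/shared/lean/pub/pub-balaban/b2b-balaban-ref1/pages/1982-cmp85-higgs23-I/…-p006, -p008, -p009, -p015,
-p016-x2.png` (pp. 608, 610, 611, 617, 618) and `…/1983-cmp88-higgs23-III/…-p002-x2.png` (p. 412), never from the OCR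
layer.

CITATION HEADER (lean-in-tree rule).  lit-balaban typed skeleton (HOME `run/shared/lean/pub/lit-balaban/`), typer
line, CARRIER module serving SKELETON row **B3.Eq1.4** (owner r15; the generating function (III.1.4) integrates the
fluctuation fields `A′_j` against `dμ_{C^{(j),L^jη}}`) — companion file `B3Eq14AuxFunction`.  WHAT IS REPRODUCED, as
definitions with bodies (no statement of the papers is asserted):

* p. 608 [PDF 6], verbatim: *"The renormalization transformations for vector fields will be obtained by taking N = d
  and an external vector field A = 0, so we will not consider them separately."* — every operator below is the
  scalar-field operator of `…HiggsCovariance` at the trivial coupling `B3MultiscaleFields.zeroCharge d` and the zero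
  external field, acting on the `ℝ^d`-valued site functions `x ↦ (A_μ(x))_μ` (`B3MultiscaleFields.toSite`).
* p. 610 [PDF 8], (2.21), verbatim: *"⟨ψ, Δ^{(k),L^kε}(Ω, A)ψ⟩ = a_k(L^kε)^{−2}⟨ψ,ψ⟩ − a_k²(L^kε)^{−4}⟨ψ,
  Q_k(A)G^ε_k(Ω, A)Q_k^*(A)ψ⟩. (2.21)"* (for `k ≥ 1`; (2.17): *"Δ^{(0),ε}(Ω, A) = −Δ^{ε,N}_{A,Ω} + m²"*) — `deltaK`, the
  operator of this quadratic form in the SOLVED form (2.21) (as the tree's `B1RG242.StepData.Δk`), case `Ω = T`.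
* p. 611 [PDF 9], (2.30), verbatim: *"We define a convariance C^{(k),L^kε}(Ω, A) by means of the quadratic form in φ
  in this integral: C^{(k),L^kε}(Ω, A) = (a(L^{k+1}ε)^{−2}P(A) + Δ^{(k),L^kε}(Ω, A))^{−1}. (2.30)"*, `P(A) = Q^*(A)Q(A)`
  the ONE-step operator of (2.20) at level `k` — `blockMean` (`P(0)`), `precOp` (the operator inverted in (2.30)),
  `fluctCov` (`C^{(k),L^kε}` itself, `Ring.inverse`; p. 611: *"It is not clear from the formulas (2.30), (2.31) that the
  covariances are well defined. It is so, and it is one of the assertions of Proposition 2.3"* — NOT asserted here).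
* p. 617 [PDF 15], verbatim: *"The fields A′_j defining the components of (3.33) are independent Gaussian random
  variables with the covariances C^{(j),L^jε}. Also they are independent of the field A on the L^kε-lattice"*, and
  p. 618 (3.35) / III p. 412 (1.4): the integrals `(a(L^{j+1}ε)^{d−2}/2π)^{(d/2)|T_1^{(j+1)}|} ∫dA′_j exp(−½⟨A′_j,
  (C^{(j),L^jε})^{−1}A′_j⟩) …` resp. `Π_{j=0}^{k−1} ∫dμ_{C^{(j),L^jη}}(A′_j) …` — `gaussWeight` (the density
  `exp(−½⟨A′_j, (C^{(j)})^{−1}A′_j⟩)` with `(C^{(j)})^{−1}` = `precOp` by (2.30)), `gaussNorm` (its Lebesgue integral),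
  `fluctMeasure` (the normalised = PROBABILITY Gaussian measure `dμ_{C^{(j),L^jη}}` on `VecField P j`, III's notation)
  and `fluctFamily` (their PRODUCT over `j < k`: the independence sentence of p. 617 as a product measure).
  PROVED (kernel, elementary): positivity/measurability/continuity of the weight, the integral formula
  `∫F dμ_{C^{(j)}} = (∫ gaussWeight)⁻¹ ∫dA′ gaussWeight(A′)F(A′)` (`integral_fluctMeasure`), and
  `IsProbabilityMeasure` GIVEN the integrability of the weight (`isProbabilityMeasure_fluctMeasure`; the integrability
  = positivity of (2.30), Prop. 2.3 (2.33), is an INPUT here, not asserted).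

CONVENTIONS.  As in `B3MultiscaleFields`: the carrier family `P` is the `η`-lattice family of III p. 412 (finest
spacing `P.mesh 0 = η`, `P.mesh j = L^jη`); the vector-field mass entering `G^η_j` and the precision `a` are the
parameters `msq`, `a` (in III's unit-lattice picture `msq = μ₀²(L^kε)²`, (I.2.22)); scalar products are (I.1.5)
`HiggsLattice.siteInner` (weight `(L^jη)^d` at level `j`); `∫dA′_j` = product Lebesgue measure on
`VecField P j = (PBond P j → ℝ)` (p. 605).  DELIBERATELY NOT HERE: Prop. 2.3 (row B1.Prop2.3), the recursion
(2.39)–(2.43) (rows B1.Eq2.39/2.41, `B1RG242`), the generating functions (I.3.35)/(III.1.4) themselves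
(`B3Eq14AuxFunction`).
Unit `lit-balaban-typer` gen 4 (literature-prover-lit-balaban-typer-g4-0); HOME/FILED.md records the proposal.
-/

open scoped BigOperators ENNReal
open _root_.MeasureTheory

namespace Literature.MathematicalPhysics.QuantumFieldTheory.Balaban1983to89.HiggsFluctMeasure

open Literature.MathematicalPhysics.QuantumFieldTheory.Balaban1983to89.HiggsLattice
open Literature.MathematicalPhysics.QuantumFieldTheory.Balaban1983to89.HiggsAveraging
open Literature.MathematicalPhysics.QuantumFieldTheory.Balaban1983to89.HiggsCovariance
open Literature.MathematicalPhysics.QuantumFieldTheory.Balaban1983to89.B3MultiscaleFields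

variable {P : Params}

/-! ## 1. The vector-field operators at *"N = d, external field A = 0"* (p. 608) -/

section Operators

/-- `Q_j` for the vector field: the averaging operator (I.2.11) at the trivial coupling and the zero external field
(all transports `U = 1`: plain block averages), on `ℝ^d`-valued site functions — `HiggsCovariance.avgQkLin` at
`B3MultiscaleFields.zeroCharge d`, external field `0`. [cite: Balaban1982Higgs1, (2.11) p.609] -/
noncomputable def vecQ (P : Params) (j : ℕ) : ScalarField P 0 P.d →ₗ[ℝ] ScalarField P j P.d :=
  avgQkLin (zeroCharge P.d) (0 : VecField P 0) j

/-- `Q_j^*` for the vector field: the adjoint averaging operator of (I.2.20) at the zero external field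
(`(Q_j^*g)(x) = g(x_j)`, `B3MultiscaleFields.qStar_apply`). [cite: Balaban1982Higgs1, (2.20) p.610] -/
noncomputable def vecQAdj (P : Params) (j : ℕ) : ScalarField P j P.d →ₗ[ℝ] ScalarField P 0 P.d :=
  avgQkAdj (zeroCharge P.d) (0 : VecField P 0) j

/-- `G^η_j` for the vector field: the propagator (I.2.20)/(I.2.22) `(−Δ^η + msq + a_j(L^jη)^{−2}P_j)^{−1}` on the whole
torus at the zero external field (`HiggsCovariance.propagatorK`, `Ring.inverse` — invertibility not asserted), the
operator inside `B3MultiscaleFields.fluctOp` ((III.1.2)). [cite: Balaban1982Higgs1, (2.20) p.610] -/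
noncomputable def vecG (P : Params) (msq a : ℝ) (j : ℕ) : Module.End ℝ (ScalarField P 0 P.d) :=
  propagatorK (zeroCharge P.d) Finset.univ (0 : VecField P 0) msq a j

/-- The coefficient `a_j(L^jη)^{−2}` of (I.2.21) (`a_j` = `B1.aSeq a L j`, (I.2.15); `L^jη` = `P.mesh j`). [cite: Balaban1982Higgs1, (2.21) p.610] -/
noncomputable def coeff221 (P : Params) (a : ℝ) (j : ℕ) : ℝ :=
  B1.aSeq a P.L j * ((P.mesh j)⁻¹ ^ 2)

/-- Unfolding of `coeff221`. [cite: Balaban1982Higgs1, (2.21) p.610] -/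
theorem coeff221_eq (a : ℝ) (j : ℕ) : coeff221 P a j = B1.aSeq a P.L j * ((P.mesh j)⁻¹ ^ 2) := rfl

/-- **`Δ^{(j),L^jη}` for the vector field** (case `Ω = T`, zero external field, `N = d`), by cases on `j` exactly as
printed: `j = 0` — (I.2.17) p. 610 *"Δ^{(0),ε}(Ω, A) = −Δ^{ε,N}_{A,Ω} + m²"* (here `−Δ^η + msq` on `ℝ^d`-valued site
functions, `HiggsCovariance.covLaplacianN` at the trivial coupling); `j ≥ 1` — the SOLVED form (I.2.21) p. 610
*"⟨ψ, Δ^{(k),L^kε}(Ω, A)ψ⟩ = a_k(L^kε)^{−2}⟨ψ,ψ⟩ − a_k²(L^kε)^{−4}⟨ψ, Q_k(A)G^ε_k(Ω, A)Q_k^*(A)ψ⟩. (2.21)"*, i.e. the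
operator `a_j(L^jη)^{−2}·1 − a_j²(L^jη)^{−4}·Q_jG^η_jQ_j^*` (the tree's schematic `B1RG242.StepData.Δk` is defined in the
same solved form). [cite: Balaban1982Higgs1, (2.21) p.610] -/
noncomputable def deltaK (P : Params) (msq a : ℝ) : (j : ℕ) → (ScalarField P j P.d →ₗ[ℝ] ScalarField P j P.d)
  | 0 => covLaplacianN (zeroCharge P.d) Finset.univ (0 : VecField P 0) + msq • LinearMap.id
  | j + 1 => coeff221 P a (j + 1) • LinearMap.id
      - (coeff221 P a (j + 1) ^ 2) • (vecQ P (j + 1) ∘ₗ vecG P msq a (j + 1) ∘ₗ vecQAdj P (j + 1))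

/-- (I.2.17) at level `0`: `Δ^{(0)} = −Δ^η + msq`. [cite: Balaban1982Higgs1, (2.17) p.610] -/
theorem deltaK_zero (msq a : ℝ) :
    deltaK P msq a 0 = covLaplacianN (zeroCharge P.d) Finset.univ (0 : VecField P 0) + msq • LinearMap.id := rfl

/-- (I.2.21) at level `j + 1`: `Δ^{(j+1)} = a_{j+1}(L^{j+1}η)^{−2}·1 − a_{j+1}²(L^{j+1}η)^{−4}·Q_{j+1}G^η_{j+1}Q_{j+1}^*`.
[cite: Balaban1982Higgs1, (2.21) p.610] -/
theorem deltaK_succ (msq a : ℝ) (j : ℕ) :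
    deltaK P msq a (j + 1) = coeff221 P a (j + 1) • LinearMap.id
      - (coeff221 P a (j + 1) ^ 2) • (vecQ P (j + 1) ∘ₗ vecG P msq a (j + 1) ∘ₗ vecQAdj P (j + 1)) := rfl

/-- (I.2.21) as printed, a statement about quadratic forms: for `j ≥ 1`,
`⟨ψ, Δ^{(j)}ψ⟩ = a_j(L^jη)^{−2}⟨ψ,ψ⟩ − a_j²(L^jη)^{−4}⟨ψ, Q_jG^η_jQ_j^*ψ⟩` (definitional unfolding of `deltaK`).
[cite: Balaban1982Higgs1, (2.21) p.610] -/
theorem siteInner_deltaK_succ (msq a : ℝ) (j : ℕ) (ψ : ScalarField P (j + 1) P.d) :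
    siteInner ψ (deltaK P msq a (j + 1) ψ)
      = coeff221 P a (j + 1) * siteInner ψ ψ
        - coeff221 P a (j + 1) ^ 2 * siteInner ψ ((vecQ P (j + 1) ∘ₗ vecG P msq a (j + 1) ∘ₗ vecQAdj P (j + 1)) ψ) := by
  simp only [deltaK_succ, LinearMap.sub_apply, LinearMap.smul_apply, LinearMap.id_apply]
  simp only [siteInner, Pi.sub_apply, Pi.smul_apply, inner_sub_right, inner_smul_right, Finset.mul_sum]
  rw [← Finset.sum_sub_distrib]
  refine Finset.sum_congr rfl fun x _ => ?_
  ring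

/-- **`P(0) = Q^*Q`, one step, zero external field** — the operator `P(A) = Q^*(A)Q(A)` of (I.2.20)/(I.2.30) from level
`j` to level `j+1` and back, at `A = 0`: `(P(0)f)(x) = L^{−d} Σ_{x′ ∈ B(x_{1})} f(x′)`, `x ∈ B(x_1)` (the mean of `f`
over the block of the next lattice containing `x`; (I.2.7) with `U = 1`, and its adjoint `g ↦ g(x_1)` for the scalar
products (I.1.5), cf. `B3MultiscaleFields.qStar_apply`). [cite: Balaban1982Higgs1, (2.30) p.611] -/
noncomputable def blockMean (P : Params) (j : ℕ) : ScalarField P j P.d →ₗ[ℝ] ScalarField P j P.d :=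
  LinearMap.pi fun x => (((P.L : ℝ) ^ P.d)⁻¹) •
    ∑ x' ∈ block (blockOf x), (LinearMap.proj x' : ScalarField P j P.d →ₗ[ℝ] EuclideanSpace ℝ (Fin P.d))

/-- `(P(0)f)(x) = L^{−d} Σ_{x′ ∈ B(x_1)} f(x′)`. [cite: Balaban1982Higgs1, (2.30) p.611] -/
theorem blockMean_apply (j : ℕ) (f : ScalarField P j P.d) (x : Site P j) :
    blockMean P j f x = (((P.L : ℝ) ^ P.d)⁻¹) • ∑ x' ∈ block (blockOf x), f x' := by
  simp [blockMean, LinearMap.sum_apply]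

/-- `P(0)` is the one-step average followed by the piecewise-constant injection: `(P(0)f)(x) = (Q(0)f)(x_1)` with
`Q(0)` = `HiggsAveraging.avgQ` at the trivial coupling ((I.2.7), `U = 1`). [cite: Balaban1982Higgs1, (2.7) p.608] -/
theorem blockMean_eq_avgQ (j : ℕ) (f : ScalarField P j P.d) (x : Site P j) :
    blockMean P j f x = avgQ (zeroCharge P.d) (0 : VecField P 0) f (blockOf x) := by
  rw [blockMean_apply, avgQ_apply]
  refine congrArg _ (Finset.sum_congr rfl fun x' _ => ?_)
  simp [zeroCharge_U]

/-- **The operator inverted in (I.2.30)** p. 611: `a(L^{j+1}η)^{−2}P(0) + Δ^{(j),L^jη}` for the vector field (zero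
external field, `N = d`, `Ω = T`) — by (2.30) this IS `(C^{(j),L^jη})^{−1}`, the operator of the quadratic form
`½⟨A′_j, (C^{(j)})^{−1}A′_j⟩` in (I.3.35)/(III.1.4). [cite: Balaban1982Higgs1, (2.30) p.611] -/
noncomputable def precOp (P : Params) (msq a : ℝ) (j : ℕ) : ScalarField P j P.d →ₗ[ℝ] ScalarField P j P.d :=
  (a * ((P.mesh (j + 1))⁻¹ ^ 2)) • blockMean P j + deltaK P msq a j

/-- Unfolding of `precOp`. [cite: Balaban1982Higgs1, (2.30) p.611] -/
theorem precOp_eq (msq a : ℝ) (j : ℕ) :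
    precOp P msq a j = (a * ((P.mesh (j + 1))⁻¹ ^ 2)) • blockMean P j + deltaK P msq a j := rfl

/-- **(I.2.30)** p. 611, verbatim: *"C^{(k),L^kε}(Ω, A) = (a(L^{k+1}ε)^{−2}P(A) + Δ^{(k),L^kε}(Ω, A))^{−1}. (2.30)"* — the
fluctuation covariance of the vector field at level `j` (`Ω = T`, `A = 0`, `N = d`), as the inverse in the endomorphism
ring (`Ring.inverse`, junk value `0` when not invertible; p. 611: *"It is not clear from the formulas (2.30), (2.31) that
the covariances are well defined. It is so, and it is one of the assertions of Proposition 2.3"* — NOT asserted here).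
[cite: Balaban1982Higgs1, (2.30) p.611] -/
noncomputable def fluctCov (P : Params) (msq a : ℝ) (j : ℕ) : Module.End ℝ (ScalarField P j P.d) :=
  Ring.inverse (precOp P msq a j : Module.End ℝ (ScalarField P j P.d))

/-- When the operator of (2.30) is invertible, `C^{(j)}` is its two-sided inverse (right form). [cite: Balaban1982Higgs1, (2.30) p.611] -/
theorem precOp_mul_fluctCov (msq a : ℝ) (j : ℕ) (h : IsUnit (precOp P msq a j : Module.End ℝ (ScalarField P j P.d))) :
    (precOp P msq a j : Module.End ℝ (ScalarField P j P.d)) * fluctCov P msq a j = 1 :=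
  Ring.mul_inverse_cancel _ h

/-- When the operator of (2.30) is invertible, `C^{(j)}` is its two-sided inverse (left form). [cite: Balaban1982Higgs1, (2.30) p.611] -/
theorem fluctCov_mul_precOp (msq a : ℝ) (j : ℕ) (h : IsUnit (precOp P msq a j : Module.End ℝ (ScalarField P j P.d))) :
    fluctCov P msq a j * (precOp P msq a j : Module.End ℝ (ScalarField P j P.d)) = 1 :=
  Ring.inverse_mul_cancel _ h

end Operators

/-! ## 2. The Gaussian measures `dμ_{C^{(j),L^jη}}(A′_j)` ((I.3.35) p. 618, (III.1.4) p. 412) -/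

section Measures

/-- The Gaussian WEIGHT of the `j`-th fluctuation field: `exp(−½⟨A′_j, (C^{(j),L^jη})^{−1}A′_j⟩)` — the integrand of
the `∫dA′_j` factors of (I.3.35) p. 618 (`(C^{(j)})^{−1}` = `precOp` by (I.2.30); scalar product (I.1.5) of the
`L^jη`-lattice; `A′_j` as the `ℝ^d`-valued site function `toSite A′_j`, p. 608). [cite: Balaban1982Higgs1, (3.35) p.618] -/
noncomputable def gaussWeight (P : Params) (msq a : ℝ) (j : ℕ) (A : VecField P j) : ℝ :=
  Real.exp (-(1 / 2 : ℝ) * siteInner (toSite A) (precOp P msq a j (toSite A)))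

/-- Unfolding of `gaussWeight`. [cite: Balaban1982Higgs1, (3.35) p.618] -/
theorem gaussWeight_eq (msq a : ℝ) (j : ℕ) (A : VecField P j) :
    gaussWeight P msq a j A = Real.exp (-(1 / 2 : ℝ) * siteInner (toSite A) (precOp P msq a j (toSite A))) := rfl

/-- The Gaussian weight is positive. [cite: Balaban1982Higgs1, (3.35) p.618] -/
theorem gaussWeight_pos (msq a : ℝ) (j : ℕ) (A : VecField P j) : 0 < gaussWeight P msq a j A :=
  Real.exp_pos _

/-- The Gaussian weight is non-negative. [cite: Balaban1982Higgs1, (3.35) p.618] -/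
theorem gaussWeight_nonneg (msq a : ℝ) (j : ℕ) (A : VecField P j) : 0 ≤ gaussWeight P msq a j A :=
  (gaussWeight_pos msq a j A).le

/-- `toSite` is a continuous linear re-indexing (each coordinate of the site function is a coordinate of the bond
function). [cite: Balaban1982Higgs1, p.608] -/
theorem continuous_toSite {j : ℕ} : Continuous (toSite : VecField P j → ScalarField P j P.d) := by
  refine continuous_pi fun x => ?_
  refine (PiLp.continuous_toLp 2 _).comp ?_
  exact continuous_pi fun μ => continuous_apply _

/-- The scalar product (I.1.5) is jointly continuous (in the form used for composites). [cite: Balaban1982Higgs1, (1.5) p.604] -/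
theorem continuous_siteInner {j N : ℕ} {X : Type*} [TopologicalSpace X] {f g : X → ScalarField P j N}
    (hf : Continuous f) (hg : Continuous g) : Continuous fun t => siteInner (f t) (g t) := by
  unfold siteInner
  refine continuous_finsetSum _ fun x _ => ?_
  exact continuous_const.mul (((continuous_apply x).comp hf).inner ((continuous_apply x).comp hg))

/-- The Gaussian weight is continuous in the field (a composite of the linear re-indexing, a linear operator on a
finite-dimensional space, the scalar product and `exp`). [cite: Balaban1982Higgs1, (3.35) p.618] -/
theorem continuous_gaussWeight (msq a : ℝ) (j : ℕ) : Continuous (gaussWeight P msq a j) := by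
  have hlin : Continuous (fun f : ScalarField P j P.d => precOp P msq a j f) :=
    LinearMap.continuous_of_finiteDimensional _
  have hq : Continuous (fun A : VecField P j => siteInner (toSite A) (precOp P msq a j (toSite A))) :=
    continuous_siteInner continuous_toSite (hlin.comp continuous_toSite)
  exact Real.continuous_exp.comp (continuous_const.mul hq)

/-- The Gaussian weight is measurable. [cite: Balaban1982Higgs1, (3.35) p.618] -/
theorem measurable_gaussWeight (msq a : ℝ) (j : ℕ) : Measurable (gaussWeight P msq a j) :=
  (continuous_gaussWeight msq a j).measurable

/-- The Lebesgue integral of the weight, `∫dA′_j exp(−½⟨A′_j,(C^{(j)})^{−1}A′_j⟩)` (`∫dA′_j` = product Lebesgue measure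
on the bond functions of `T^{(j)}`, p. 605) — the normalisation turning the `∫dA′_j` factor of (I.3.35) into III's
probability measure `dμ_{C^{(j),L^jη}}` (value `0` by Lean's convention if the weight is not integrable).
[cite: Balaban1982Higgs1, (3.35) p.618] -/
noncomputable def gaussNorm (P : Params) (msq a : ℝ) (j : ℕ) : ℝ :=
  ∫ A : VecField P j, gaussWeight P msq a j A

/-- Unfolding of `gaussNorm`. [cite: Balaban1982Higgs1, (3.35) p.618] -/
theorem gaussNorm_eq (msq a : ℝ) (j : ℕ) : gaussNorm P msq a j = ∫ A : VecField P j, gaussWeight P msq a j A := rfl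

/-- The normalisation is non-negative. [cite: Balaban1982Higgs1, (3.35) p.618] -/
theorem gaussNorm_nonneg (msq a : ℝ) (j : ℕ) : 0 ≤ gaussNorm P msq a j :=
  integral_nonneg fun A => gaussWeight_nonneg msq a j A

/-- If the weight is integrable, the normalisation is positive (the weight is a positive continuous function and
Lebesgue measure charges open sets). [cite: Balaban1982Higgs1, (3.35) p.618] -/
theorem gaussNorm_pos (msq a : ℝ) (j : ℕ) (hint : Integrable (gaussWeight P msq a j)) : 0 < gaussNorm P msq a j := by
  rw [gaussNorm_eq, integral_pos_iff_support_of_nonneg (fun A => gaussWeight_nonneg msq a j A) hint]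
  have hsupp : Function.support (gaussWeight P msq a j) = Set.univ :=
    Set.eq_univ_of_forall fun A => Function.mem_support.mpr (gaussWeight_pos msq a j A).ne'
  rw [hsupp]
  exact isOpen_univ.measure_pos _ Set.univ_nonempty

/-- **`dμ_{C^{(j),L^jη}}(A′_j)`** — the centred Gaussian PROBABILITY measure on the fluctuation fields `A′_j` (bond
functions on `T^{(j)}`, `VecField P j`) with covariance `C^{(j),L^jη}`: density `exp(−½⟨A′_j,(C^{(j)})^{−1}A′_j⟩)/gaussNorm`
with respect to Lebesgue measure `dA′_j`.  III p. 412 (1.4): *"∫dμ_{C^{(j),L^jη}}(A′_j)"*; I p. 617: *"The fields A′_j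
… are independent Gaussian random variables with the covariances C^{(j),L^jε}"*; I (3.35) writes the same integrals
as `(a(L^{j+1}ε)^{d−2}/2π)^{(d/2)|T_1^{(j+1)}|}∫dA′_j exp(−½⟨A′_j,(C^{(j),L^jε})^{−1}A′_j⟩)(…)`, i.e. `Z^{(j)}·∫(…)dμ_{C^{(j)}}`
with `Z^{(j)}` of (I.2.18). (When the weight is not integrable this is a junk measure; `isProbabilityMeasure_fluctMeasure`.)
[cite: Balaban1983Higgs3, (1.4) p.412] -/
noncomputable def fluctMeasure (P : Params) (msq a : ℝ) (j : ℕ) : Measure (VecField P j) :=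
  (ENNReal.ofReal (gaussNorm P msq a j))⁻¹ •
    (volume : Measure (VecField P j)).withDensity fun A => ENNReal.ofReal (gaussWeight P msq a j A)

/-- Unfolding of `fluctMeasure`. [cite: Balaban1983Higgs3, (1.4) p.412] -/
theorem fluctMeasure_eq (msq a : ℝ) (j : ℕ) :
    fluctMeasure P msq a j = (ENNReal.ofReal (gaussNorm P msq a j))⁻¹ •
      (volume : Measure (VecField P j)).withDensity fun A => ENNReal.ofReal (gaussWeight P msq a j A) := rfl

/-- **Integration against `dμ_{C^{(j)}}` is the normalised Gaussian integral**:
`∫ F dμ_{C^{(j),L^jη}} = (∫dA′ e^{−½⟨A′,(C^{(j)})^{−1}A′⟩})⁻¹ · ∫dA′ e^{−½⟨A′,(C^{(j)})^{−1}A′⟩} F(A′)` — the dictionary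
between III's `dμ` (1.4) and I's explicit Gaussian integrals (3.35). PROVED. [cite: Balaban1983Higgs3, (1.4) p.412] -/
theorem integral_fluctMeasure (msq a : ℝ) (j : ℕ) {E : Type*} [NormedAddCommGroup E] [NormedSpace ℝ E]
    (F : VecField P j → E) :
    ∫ A, F A ∂(fluctMeasure P msq a j)
      = (gaussNorm P msq a j)⁻¹ • ∫ A : VecField P j, gaussWeight P msq a j A • F A := by
  rw [fluctMeasure_eq, integral_smul_measure,
    integral_withDensity_eq_integral_toReal_smul₀ (measurable_gaussWeight msq a j).ennreal_ofReal.aemeasurable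
      (Filter.Eventually.of_forall fun _ => ENNReal.ofReal_lt_top)]
  simp only [ENNReal.toReal_inv, ENNReal.toReal_ofReal (gaussNorm_nonneg msq a j),
    ENNReal.toReal_ofReal (gaussWeight_nonneg msq a j _)]

/-- The total mass of `dμ_{C^{(j)}}`: `(gaussNorm)⁻¹ · ∫⁻ weight`. [cite: Balaban1983Higgs3, (1.4) p.412] -/
theorem fluctMeasure_univ (msq a : ℝ) (j : ℕ) :
    fluctMeasure P msq a j Set.univ
      = (ENNReal.ofReal (gaussNorm P msq a j))⁻¹ * ∫⁻ A : VecField P j, ENNReal.ofReal (gaussWeight P msq a j A) := by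
  rw [fluctMeasure_eq, Measure.smul_apply, withDensity_apply _ MeasurableSet.univ, Measure.restrict_univ, smul_eq_mul]

/-- **`dμ_{C^{(j),L^jη}}` is a probability measure** as soon as the Gaussian weight is integrable (equivalently: the
operator of (I.2.30) is positive definite — the content of Prop. 2.3 (2.33) p. 611, an INPUT here). PROVED from the
integral formula. [cite: Balaban1983Higgs3, (1.4) p.412] -/
theorem isProbabilityMeasure_fluctMeasure (msq a : ℝ) (j : ℕ) (hint : Integrable (gaussWeight P msq a j)) :
    IsProbabilityMeasure (fluctMeasure P msq a j) := by
  constructor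
  rw [fluctMeasure_univ,
    ← ofReal_integral_eq_lintegral_ofReal hint (Filter.Eventually.of_forall fun A => gaussWeight_nonneg msq a j A),
    ← gaussNorm_eq]
  exact ENNReal.inv_mul_cancel (ENNReal.ofReal_pos.mpr (gaussNorm_pos msq a j hint)).ne' ENNReal.ofReal_ne_top

/-- **The product measure `Π_{j<k} dμ_{C^{(j),L^jη}}(A′_j)`** on the families `(A′_j)_{j<k}` of fluctuation fields —
III (1.4) p. 412: *"Π_{j=0}^{k−1} ∫dμ_{C^{(j),L^jη}}(A′_j)"*; I p. 617: *"The fields A′_j defining the components of (3.33)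
are independent Gaussian random variables with the covariances C^{(j),L^jε}"* (independence = product measure).
[cite: Balaban1983Higgs3, (1.4) p.412] -/
noncomputable def fluctFamily (P : Params) (msq a : ℝ) (k : ℕ) : Measure ((j : Fin k) → VecField P j) :=
  Measure.pi fun j : Fin k => fluctMeasure P msq a j

/-- Unfolding of `fluctFamily`. [cite: Balaban1983Higgs3, (1.4) p.412] -/
theorem fluctFamily_eq (msq a : ℝ) (k : ℕ) :
    fluctFamily P msq a k = Measure.pi fun j : Fin k => fluctMeasure P msq a j := rfl

/-- The product of the `dμ_{C^{(j)}}`, `j < k`, is a probability measure when each factor is (each weight integrable).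
[cite: Balaban1983Higgs3, (1.4) p.412] -/
theorem isProbabilityMeasure_fluctFamily (msq a : ℝ) (k : ℕ)
    (hint : ∀ j : Fin k, Integrable (gaussWeight P msq a j)) :
    IsProbabilityMeasure (fluctFamily P msq a k) := by
  haveI : ∀ j : Fin k, IsProbabilityMeasure (fluctMeasure P msq a j) :=
    fun j => isProbabilityMeasure_fluctMeasure msq a j (hint j)
  rw [fluctFamily_eq]
  infer_instance

/-- With no step done (`k = 0`) there are no fluctuation fields: the product measure is the Dirac mass at the empty
family, so `∫ F dμ = F(∅)`. [cite: Balaban1983Higgs3, (1.4) p.412] -/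
theorem fluctFamily_zero (msq a : ℝ) :
    fluctFamily P msq a 0 = Measure.dirac (fun j : Fin 0 => j.elim0) := by
  rw [fluctFamily_eq, Measure.pi_of_empty]
  exact congrArg _ (funext fun j => j.elim0)

end Measures

end Literature.MathematicalPhysics.QuantumFieldTheory.Balaban1983to89.HiggsFluctMeasure
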